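import Mathlib
import HarnessLib

/-!
# LINE (A) `product_plus_one` (crux `MatrixDescartes`, stmt-ValiantsHypothesis-18050, V1) — EB2-W, RUNG R (the REAL-ROOTED LAW), part 1a:
# the ROOT KERNEL `F(x) = Σ_i w_i ρ_i/(x − ρ_i)²` — derivatives, the REARRANGEMENT inequalities, the shift `σ`

Owner memo `pub/ideators/val-idea-25/NOTE-idea25g3-18050-LINEA-AB-reduction.md` §17 (val-idea-25 g4): for a real-rooted `P` the log-Wronskian
`W(P) = P·θ²P − (θP)²` (`θ = X·d/dX`) satisfies `W(P)(x) = −x·P(x)²·F(x)` with the ROOT KERNEL `F(x) = Σ_ρ m_ρ·ρ/(x − ρ)²` over the distinct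
roots `ρ` (multiplicities `m_ρ`), and CLAIM R says: `F` has at most TWO zeros in each window between consecutive positive roots and at most ONE
in each outer window.  The memo's proof is the Laplace-transform sign rule (Pólya–Szegő V, 77–80); this file and `…RealRootedWindows` give an
ELEMENTARY proof for arbitrary positive real weights `w_i` (index set `s`, roots `ρ_i`, repeats allowed).  Here:

* §1 `hasDerivAt_const_div_sub_pow`, `hasDerivAt_rootKernel`, `hasDerivAt_rootKernel_two/three` — `d/dx Σ w_iρ_i/(x−ρ_i)^{k+1} = −(k+1)Σ w_iρ_i/(x−ρ_i)^{k+2}`;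
* §2 THE REARRANGEMENT (replaces the Laplace density): for fixed `x`, `σ` the weight `χ(ρ) = e^{−ρσ}(6 − 2σ(x−ρ))/(x−ρ)⁴` is strictly increasing
  in `ρ < x` (`hasDerivAt_chi2`: derivative `2e^{−ρσ}((σ(x−ρ)−3)² + 3)/(x−ρ)⁵ > 0`, `strictMonoOn_chi2`) and `χ̃(ρ) = e^{−ρσ}(σ(x−ρ) − 2)/(x−ρ)³`
  strictly decreasing (`hasDerivAt_chi1`: `−e^{−ρσ}((σ(x−ρ)−2)² + 2)/(x−ρ)⁴ < 0`, `strictAntiOn_chi1`); hence termwise, comparing with `ρ = 0`,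
  `wρ(6−2σ(x−ρ))/(x−ρ)⁴ ≥ ((6−2σx)/x⁴)·wρe^{ρσ}` and `wρ(σ(x−ρ)−2)/(x−ρ)³ ≤ ((σx−2)/x³)·wρe^{ρσ}` (`key2_term`, `key1_term`, `key1_term_strict`),
  summed `key2_sum`, `key1_sum_strict`;
* §3 `exists_sigma` — if some root is positive there is `σ ≥ 0` with `Σ w_iρ_ie^{ρ_iσ} = 0`, or `σ = 0` and `Σ w_iρ_i ≥ 0` (continuity,
  `e^t ≥ 1 + t`, IVT).

Honest framing: calculus on root sums; bounds no LINE decl by itself; NOT `WronskianBudgetK3` / `OneChangeFloorK3` / `stub_polyLaw` /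
`MatrixDescartes` / B; `VP ≠ VNP` NOT proved.  No definitions, no named facts; Mathlib only.
-/

set_option linter.dupNamespace false

namespace Summit.ValiantsHypothesis.ValiantsHypothesis.Theorems.LacunarySymmetroidMatrixDescartes

namespace ProductPlusOne

open Finset Set
open scoped BigOperators Topology

/-! ### §1 Derivatives of the root kernels `Σ w_iρ_i/(x − ρ_i)^k` -/

/-- `d/dt [c/(t − ρ)^{k+1}] = −(k+1)c/(t − ρ)^{k+2}` at `t = x ≠ ρ`. [folklore] -/
theorem hasDerivAt_const_div_sub_pow (c ρ : ℝ) (k : ℕ) {x : ℝ} (hx : x ≠ ρ) :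
    HasDerivAt (fun t : ℝ => c / (t - ρ) ^ (k + 1)) (-(((k : ℝ) + 1) * c) / (x - ρ) ^ (k + 2)) x := by
  have hxρ : x - ρ ≠ 0 := sub_ne_zero.2 hx
  have h0 : HasDerivAt (fun t : ℝ => t - ρ) 1 x := (hasDerivAt_id' x).sub_const ρ
  have h1 : HasDerivAt (fun t : ℝ => (t - ρ) ^ (k + 1)) (((k + 1 : ℕ) : ℝ) * (x - ρ) ^ (k + 1 - 1) * 1) x :=
    h0.pow (k + 1)
  have h2 : HasDerivAt (fun t : ℝ => c * ((t - ρ) ^ (k + 1))⁻¹)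
      (c * (-(((k + 1 : ℕ) : ℝ) * (x - ρ) ^ (k + 1 - 1) * 1) / ((x - ρ) ^ (k + 1)) ^ 2)) x :=
    (h1.inv (pow_ne_zero _ hxρ)).const_mul c
  have h3 : HasDerivAt (fun t : ℝ => c / (t - ρ) ^ (k + 1))
      (c * (-(((k + 1 : ℕ) : ℝ) * (x - ρ) ^ (k + 1 - 1) * 1) / ((x - ρ) ^ (k + 1)) ^ 2)) x :=
    h2.congr_of_eventuallyEq (Filter.Eventually.of_forall fun t => by simp [div_eq_mul_inv])
  refine h3.congr_deriv ?_
  rw [Nat.add_sub_cancel]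
  push_cast
  field_simp
  ring

/-- `d/dt Σ_i w_iρ_i/(t − ρ_i)^{k+1} = Σ_i −(k+1)w_iρ_i/(t − ρ_i)^{k+2}` away from the roots. [folklore] -/
theorem hasDerivAt_rootKernel {ι : Type*} (s : Finset ι) (w ρ : ι → ℝ) (k : ℕ) {x : ℝ} (hx : ∀ i ∈ s, x ≠ ρ i) :
    HasDerivAt (fun t : ℝ => ∑ i ∈ s, w i * ρ i / (t - ρ i) ^ (k + 1))
      (∑ i ∈ s, -(((k : ℝ) + 1) * (w i * ρ i)) / (x - ρ i) ^ (k + 2)) x :=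
  HasDerivAt.fun_sum fun i hi => hasDerivAt_const_div_sub_pow (w i * ρ i) (ρ i) k (hx i hi)

/-- `F′ = −2Σ w_iρ_i/(x−ρ_i)³` for `F = Σ w_iρ_i/(x−ρ_i)²`. [folklore] -/
theorem hasDerivAt_rootKernel_two {ι : Type*} (s : Finset ι) (w ρ : ι → ℝ) {x : ℝ} (hx : ∀ i ∈ s, x ≠ ρ i) :
    HasDerivAt (fun t : ℝ => ∑ i ∈ s, w i * ρ i / (t - ρ i) ^ 2)
      (∑ i ∈ s, -2 * (w i * ρ i) / (x - ρ i) ^ 3) x := by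
  refine (hasDerivAt_rootKernel s w ρ 1 hx).congr_deriv (Finset.sum_congr rfl fun i _ => ?_)
  norm_num

/-- `(F′)′ = 6Σ w_iρ_i/(x−ρ_i)⁴` for `F′ = −2Σ w_iρ_i/(x−ρ_i)³`. [folklore] -/
theorem hasDerivAt_rootKernel_three {ι : Type*} (s : Finset ι) (w ρ : ι → ℝ) {x : ℝ} (hx : ∀ i ∈ s, x ≠ ρ i) :
    HasDerivAt (fun t : ℝ => ∑ i ∈ s, -2 * (w i * ρ i) / (t - ρ i) ^ 3)
      (∑ i ∈ s, 6 * (w i * ρ i) / (x - ρ i) ^ 4) x := by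
  have h := hasDerivAt_rootKernel s (fun i => -2 * w i) ρ 2 hx
  refine (h.congr_of_eventuallyEq (Filter.Eventually.of_forall fun t => ?_)).congr_deriv ?_
  · exact Finset.sum_congr rfl fun i _ => by ring
  · refine Finset.sum_congr rfl fun i _ => ?_
    norm_num
    ring

/-! ### §2 The rearrangement inequalities -/

/-- Derivative of the second-order weight `χ(ρ) = e^{−ρσ}(6 − 2σ(x−ρ))/(x−ρ)⁴` in `ρ < x`:
`2e^{−ρσ}((σ(x−ρ) − 3)² + 3)/(x−ρ)⁵`. [this file's lemma] -/
theorem hasDerivAt_chi2 (x σ : ℝ) {r : ℝ} (hr : r < x) :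
    HasDerivAt (fun ρ : ℝ => Real.exp (-(σ * ρ)) * (6 - 2 * σ * (x - ρ)) / (x - ρ) ^ 4)
      (2 * Real.exp (-(σ * r)) * ((σ * (x - r) - 3) ^ 2 + 3) / (x - r) ^ 5) r := by
  have hc : x - r ≠ 0 := sub_ne_zero.2 (ne_of_gt hr)
  have h1 : HasDerivAt (fun ρ : ℝ => -(σ * ρ)) (-(σ * 1)) r := ((hasDerivAt_id' r).const_mul σ).neg
  have hE : HasDerivAt (fun ρ : ℝ => Real.exp (-(σ * ρ))) (Real.exp (-(σ * r)) * -(σ * 1)) r := h1.exp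
  have h2 : HasDerivAt (fun ρ : ℝ => x - ρ) (0 - 1) r := (hasDerivAt_const r x).sub (hasDerivAt_id' r)
  have hL : HasDerivAt (fun ρ : ℝ => 6 - 2 * σ * (x - ρ)) (0 - 2 * σ * (0 - 1)) r :=
    (hasDerivAt_const r 6).sub (h2.const_mul (2 * σ))
  have h4 : HasDerivAt (fun ρ : ℝ => (x - ρ) ^ 4) (((4 : ℕ) : ℝ) * (x - r) ^ (4 - 1) * (0 - 1)) r := h2.pow 4
  have hI : HasDerivAt (fun ρ : ℝ => ((x - ρ) ^ 4)⁻¹)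
      (-(((4 : ℕ) : ℝ) * (x - r) ^ (4 - 1) * (0 - 1)) / ((x - r) ^ 4) ^ 2) r := h4.inv (pow_ne_zero _ hc)
  have hχ := (hE.fun_mul hL).fun_mul hI
  have hfun : (fun ρ : ℝ => Real.exp (-(σ * ρ)) * (6 - 2 * σ * (x - ρ)) / (x - ρ) ^ 4)
      = fun ρ => Real.exp (-(σ * ρ)) * (6 - 2 * σ * (x - ρ)) * ((x - ρ) ^ 4)⁻¹ := by
    funext ρ; rw [div_eq_mul_inv]
  rw [hfun]
  refine hχ.congr_deriv ?_
  push_cast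
  field_simp
  ring

/-- Derivative of the first-order weight `χ̃(ρ) = e^{−ρσ}(σ(x−ρ) − 2)/(x−ρ)³` in `ρ < x`:
`−e^{−ρσ}((σ(x−ρ) − 2)² + 2)/(x−ρ)⁴`. [this file's lemma] -/
theorem hasDerivAt_chi1 (x σ : ℝ) {r : ℝ} (hr : r < x) :
    HasDerivAt (fun ρ : ℝ => Real.exp (-(σ * ρ)) * (σ * (x - ρ) - 2) / (x - ρ) ^ 3)
      (-(Real.exp (-(σ * r)) * ((σ * (x - r) - 2) ^ 2 + 2)) / (x - r) ^ 4) r := by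
  have hc : x - r ≠ 0 := sub_ne_zero.2 (ne_of_gt hr)
  have h1 : HasDerivAt (fun ρ : ℝ => -(σ * ρ)) (-(σ * 1)) r := ((hasDerivAt_id' r).const_mul σ).neg
  have hE : HasDerivAt (fun ρ : ℝ => Real.exp (-(σ * ρ))) (Real.exp (-(σ * r)) * -(σ * 1)) r := h1.exp
  have h2 : HasDerivAt (fun ρ : ℝ => x - ρ) (0 - 1) r := (hasDerivAt_const r x).sub (hasDerivAt_id' r)
  have hL : HasDerivAt (fun ρ : ℝ => σ * (x - ρ) - 2) (σ * (0 - 1) - 0) r :=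
    (h2.const_mul σ).sub (hasDerivAt_const r 2)
  have h3 : HasDerivAt (fun ρ : ℝ => (x - ρ) ^ 3) (((3 : ℕ) : ℝ) * (x - r) ^ (3 - 1) * (0 - 1)) r := h2.pow 3
  have hI : HasDerivAt (fun ρ : ℝ => ((x - ρ) ^ 3)⁻¹)
      (-(((3 : ℕ) : ℝ) * (x - r) ^ (3 - 1) * (0 - 1)) / ((x - r) ^ 3) ^ 2) r := h3.inv (pow_ne_zero _ hc)
  have hχ := (hE.fun_mul hL).fun_mul hI
  have hfun : (fun ρ : ℝ => Real.exp (-(σ * ρ)) * (σ * (x - ρ) - 2) / (x - ρ) ^ 3)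
      = fun ρ => Real.exp (-(σ * ρ)) * (σ * (x - ρ) - 2) * ((x - ρ) ^ 3)⁻¹ := by
    funext ρ; rw [div_eq_mul_inv]
  rw [hfun]
  refine hχ.congr_deriv ?_
  push_cast
  field_simp
  ring

/-- `χ` is strictly increasing on `(−∞, x)`. [this file's lemma] -/
theorem strictMonoOn_chi2 (x σ : ℝ) :
    StrictMonoOn (fun ρ : ℝ => Real.exp (-(σ * ρ)) * (6 - 2 * σ * (x - ρ)) / (x - ρ) ^ 4) (Iio x) := by
  refine strictMonoOn_of_deriv_pos (convex_Iio x) ?_ ?_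
  · exact fun r hr => (hasDerivAt_chi2 x σ hr).continuousAt.continuousWithinAt
  · intro r hr
    rw [interior_Iio] at hr
    rw [(hasDerivAt_chi2 x σ hr).deriv]
    have hc : 0 < x - r := sub_pos.2 hr
    positivity

/-- `χ̃` is strictly decreasing on `(−∞, x)`. [this file's lemma] -/
theorem strictAntiOn_chi1 (x σ : ℝ) :
    StrictAntiOn (fun ρ : ℝ => Real.exp (-(σ * ρ)) * (σ * (x - ρ) - 2) / (x - ρ) ^ 3) (Iio x) := by
  refine strictAntiOn_of_deriv_neg (convex_Iio x) ?_ ?_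
  · exact fun r hr => (hasDerivAt_chi1 x σ hr).continuousAt.continuousWithinAt
  · intro r hr
    rw [interior_Iio] at hr
    rw [(hasDerivAt_chi1 x σ hr).deriv]
    have hc : 0 < x - r := sub_pos.2 hr
    have hnum : 0 < Real.exp (-(σ * r)) * ((σ * (x - r) - 2) ^ 2 + 2) := by positivity
    have hden : 0 < (x - r) ^ 4 := by positivity
    rw [neg_div]
    exact neg_neg_of_pos (div_pos hnum hden)

/-- **Second-order rearrangement, termwise**: for `w ≥ 0`, `ρ < x`, `0 < x`:
`w·ρ(6 − 2σ(x−ρ))/(x−ρ)⁴ ≥ ((6 − 2σx)/x⁴)·(wρe^{ρσ})`. [this file's lemma] -/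
theorem key2_term (x σ w ρ : ℝ) (hx : 0 < x) (hρ : ρ < x) (hw : 0 ≤ w) :
    (6 - 2 * σ * x) / x ^ 4 * (w * ρ * Real.exp (σ * ρ)) ≤ w * ρ * (6 - 2 * σ * (x - ρ)) / (x - ρ) ^ 4 := by
  have hmono := strictMonoOn_chi2 x σ
  have h0 : (0 : ℝ) ∈ Iio x := hx
  have hρ' : ρ ∈ Iio x := hρ
  -- `χ(0) = (6 − 2σx)/x⁴`
  have hχ0 : Real.exp (-(σ * 0)) * (6 - 2 * σ * (x - 0)) / (x - 0) ^ 4 = (6 - 2 * σ * x) / x ^ 4 := by simp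
  -- `wρe^{ρσ}·χ(ρ) = wρ(6 − 2σ(x−ρ))/(x−ρ)⁴`
  have hχρ : w * ρ * Real.exp (σ * ρ) * (Real.exp (-(σ * ρ)) * (6 - 2 * σ * (x - ρ)) / (x - ρ) ^ 4)
      = w * ρ * (6 - 2 * σ * (x - ρ)) / (x - ρ) ^ 4 := by
    rw [mul_div_assoc, ← mul_assoc, mul_assoc (w * ρ), ← Real.exp_add, add_neg_cancel, Real.exp_zero, mul_one,
      mul_div_assoc]
  rw [← hχρ, ← hχ0, mul_comm ((Real.exp (-(σ * 0)) * (6 - 2 * σ * (x - 0)) / (x - 0) ^ 4)) (w * ρ * Real.exp (σ * ρ))]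
  rcases le_or_gt 0 ρ with hρ0 | hρ0
  · have hle : Real.exp (-(σ * 0)) * (6 - 2 * σ * (x - 0)) / (x - 0) ^ 4
        ≤ Real.exp (-(σ * ρ)) * (6 - 2 * σ * (x - ρ)) / (x - ρ) ^ 4 := hmono.monotoneOn h0 hρ' hρ0
    exact mul_le_mul_of_nonneg_left hle (mul_nonneg (mul_nonneg hw hρ0) (Real.exp_pos _).le)
  · have hle : Real.exp (-(σ * ρ)) * (6 - 2 * σ * (x - ρ)) / (x - ρ) ^ 4
        ≤ Real.exp (-(σ * 0)) * (6 - 2 * σ * (x - 0)) / (x - 0) ^ 4 := hmono.monotoneOn hρ' h0 hρ0.le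
    have hnp : w * ρ * Real.exp (σ * ρ) ≤ 0 :=
      mul_nonpos_of_nonpos_of_nonneg (mul_nonpos_of_nonneg_of_nonpos hw hρ0.le) (Real.exp_pos _).le
    exact mul_le_mul_of_nonpos_left hle hnp

/-- **First-order rearrangement, termwise**: for `w ≥ 0`, `ρ < x`, `0 < x`:
`w·ρ(σ(x−ρ) − 2)/(x−ρ)³ ≤ ((σx − 2)/x³)·(wρe^{ρσ})`, STRICT when `w > 0` and `ρ ≠ 0`. [this file's lemma] -/
theorem key1_term (x σ w ρ : ℝ) (hx : 0 < x) (hρ : ρ < x) (hw : 0 ≤ w) :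
    w * ρ * (σ * (x - ρ) - 2) / (x - ρ) ^ 3 ≤ (σ * x - 2) / x ^ 3 * (w * ρ * Real.exp (σ * ρ)) := by
  have hanti := strictAntiOn_chi1 x σ
  have h0 : (0 : ℝ) ∈ Iio x := hx
  have hρ' : ρ ∈ Iio x := hρ
  have hχ0 : Real.exp (-(σ * 0)) * (σ * (x - 0) - 2) / (x - 0) ^ 3 = (σ * x - 2) / x ^ 3 := by simp
  have hχρ : w * ρ * Real.exp (σ * ρ) * (Real.exp (-(σ * ρ)) * (σ * (x - ρ) - 2) / (x - ρ) ^ 3)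
      = w * ρ * (σ * (x - ρ) - 2) / (x - ρ) ^ 3 := by
    rw [mul_div_assoc, ← mul_assoc, mul_assoc (w * ρ), ← Real.exp_add, add_neg_cancel, Real.exp_zero, mul_one,
      mul_div_assoc]
  rw [← hχρ, ← hχ0, mul_comm ((Real.exp (-(σ * 0)) * (σ * (x - 0) - 2) / (x - 0) ^ 3)) (w * ρ * Real.exp (σ * ρ))]
  rcases le_or_gt 0 ρ with hρ0 | hρ0
  · have hle : Real.exp (-(σ * ρ)) * (σ * (x - ρ) - 2) / (x - ρ) ^ 3
        ≤ Real.exp (-(σ * 0)) * (σ * (x - 0) - 2) / (x - 0) ^ 3 := hanti.antitoneOn h0 hρ' hρ0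
    exact mul_le_mul_of_nonneg_left hle (mul_nonneg (mul_nonneg hw hρ0) (Real.exp_pos _).le)
  · have hle : Real.exp (-(σ * 0)) * (σ * (x - 0) - 2) / (x - 0) ^ 3
        ≤ Real.exp (-(σ * ρ)) * (σ * (x - ρ) - 2) / (x - ρ) ^ 3 := hanti.antitoneOn hρ' h0 hρ0.le
    have hnp : w * ρ * Real.exp (σ * ρ) ≤ 0 :=
      mul_nonpos_of_nonpos_of_nonneg (mul_nonpos_of_nonneg_of_nonpos hw hρ0.le) (Real.exp_pos _).le
    exact mul_le_mul_of_nonpos_left hle hnp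

/-- The first-order termwise inequality is STRICT for `w > 0`, `ρ ≠ 0`. [this file's lemma] -/
theorem key1_term_strict (x σ w ρ : ℝ) (hx : 0 < x) (hρ : ρ < x) (hw : 0 < w) (hρ0 : ρ ≠ 0) :
    w * ρ * (σ * (x - ρ) - 2) / (x - ρ) ^ 3 < (σ * x - 2) / x ^ 3 * (w * ρ * Real.exp (σ * ρ)) := by
  have hanti := strictAntiOn_chi1 x σ
  have h0 : (0 : ℝ) ∈ Iio x := hx
  have hρ' : ρ ∈ Iio x := hρ
  have hχ0 : Real.exp (-(σ * 0)) * (σ * (x - 0) - 2) / (x - 0) ^ 3 = (σ * x - 2) / x ^ 3 := by simp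
  have hχρ : w * ρ * Real.exp (σ * ρ) * (Real.exp (-(σ * ρ)) * (σ * (x - ρ) - 2) / (x - ρ) ^ 3)
      = w * ρ * (σ * (x - ρ) - 2) / (x - ρ) ^ 3 := by
    rw [mul_div_assoc, ← mul_assoc, mul_assoc (w * ρ), ← Real.exp_add, add_neg_cancel, Real.exp_zero, mul_one,
      mul_div_assoc]
  rw [← hχρ, ← hχ0, mul_comm ((Real.exp (-(σ * 0)) * (σ * (x - 0) - 2) / (x - 0) ^ 3)) (w * ρ * Real.exp (σ * ρ))]
  rcases lt_or_gt_of_ne hρ0 with hρn | hρp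
  · have hlt : Real.exp (-(σ * 0)) * (σ * (x - 0) - 2) / (x - 0) ^ 3
        < Real.exp (-(σ * ρ)) * (σ * (x - ρ) - 2) / (x - ρ) ^ 3 := hanti hρ' h0 hρn
    have hneg : w * ρ * Real.exp (σ * ρ) < 0 :=
      mul_neg_of_neg_of_pos (mul_neg_of_pos_of_neg hw hρn) (Real.exp_pos _)
    exact mul_lt_mul_of_neg_left hlt hneg
  · have hlt : Real.exp (-(σ * ρ)) * (σ * (x - ρ) - 2) / (x - ρ) ^ 3
        < Real.exp (-(σ * 0)) * (σ * (x - 0) - 2) / (x - 0) ^ 3 := hanti h0 hρ' hρp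
    exact mul_lt_mul_of_pos_left hlt (mul_pos (mul_pos hw hρp) (Real.exp_pos _))

/-- **Second-order rearrangement, summed** over roots `ρ_i < x` with weights `w_i ≥ 0`:
`Σ w_iρ_i(6 − 2σ(x−ρ_i))/(x−ρ_i)⁴ ≥ ((6 − 2σx)/x⁴)·Σ w_iρ_ie^{ρ_iσ}`. [this file's lemma] -/
theorem key2_sum {ι : Type*} (L : Finset ι) (w ρ : ι → ℝ) (x σ : ℝ) (hx : 0 < x)
    (hρ : ∀ i ∈ L, ρ i < x) (hw : ∀ i ∈ L, 0 ≤ w i) :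
    (6 - 2 * σ * x) / x ^ 4 * ∑ i ∈ L, w i * ρ i * Real.exp (σ * ρ i)
      ≤ ∑ i ∈ L, w i * ρ i * (6 - 2 * σ * (x - ρ i)) / (x - ρ i) ^ 4 := by
  rw [Finset.mul_sum]
  exact Finset.sum_le_sum fun i hi => key2_term x σ (w i) (ρ i) hx (hρ i hi) (hw i hi)

/-- **First-order rearrangement, summed**, STRICT when some `ρ_i ≠ 0` (weights `w_i > 0`):
`Σ w_iρ_i(σ(x−ρ_i) − 2)/(x−ρ_i)³ < ((σx − 2)/x³)·Σ w_iρ_ie^{ρ_iσ}`. [this file's lemma] -/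
theorem key1_sum_strict {ι : Type*} (L : Finset ι) (w ρ : ι → ℝ) (x σ : ℝ) (hx : 0 < x)
    (hρ : ∀ i ∈ L, ρ i < x) (hw : ∀ i ∈ L, 0 < w i) (hne : ∃ i ∈ L, ρ i ≠ 0) :
    ∑ i ∈ L, w i * ρ i * (σ * (x - ρ i) - 2) / (x - ρ i) ^ 3
      < (σ * x - 2) / x ^ 3 * ∑ i ∈ L, w i * ρ i * Real.exp (σ * ρ i) := by
  obtain ⟨k, hk, hk0⟩ := hne
  rw [Finset.mul_sum]
  exact Finset.sum_lt_sum (fun i hi => key1_term x σ (w i) (ρ i) hx (hρ i hi) (hw i hi).le)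
    ⟨k, hk, key1_term_strict x σ (w k) (ρ k) hx (hρ k hk) (hw k hk) hk0⟩

/-! ### §3 The shift `σ`: a zero of `g(σ) = Σ_left w_iρ_ie^{ρ_iσ}` (or `σ = 0` when `g(0) ≥ 0`) -/

/-- **Existence of the shift**: if some root in `L` is positive (weights `> 0`) there is `σ ≥ 0` with `Σ_L w_iρ_ie^{ρ_iσ} = 0`, or
`σ = 0` and `Σ_L w_iρ_i ≥ 0`. [this file's lemma] -/
theorem exists_sigma {ι : Type*} (L : Finset ι) (w ρ : ι → ℝ) (hw : ∀ i ∈ L, 0 < w i) (hpos : ∃ i ∈ L, 0 < ρ i) :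
    ∃ σ : ℝ, 0 ≤ σ ∧ (∑ i ∈ L, w i * ρ i * Real.exp (σ * ρ i) = 0 ∨
      (σ = 0 ∧ 0 ≤ ∑ i ∈ L, w i * ρ i)) := by
  classical
  set g : ℝ → ℝ := fun σ => ∑ i ∈ L, w i * ρ i * Real.exp (σ * ρ i) with hg
  by_cases h0 : 0 ≤ ∑ i ∈ L, w i * ρ i
  · exact ⟨0, le_rfl, Or.inr ⟨rfl, h0⟩⟩
  push Not at h0
  obtain ⟨k, hk, hρk⟩ := hpos
  -- an explicit point where `g ≥ 0`
  set N : ℝ := ∑ i ∈ L.erase k, |w i * ρ i| with hN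
  have hN0 : 0 ≤ N := Finset.sum_nonneg fun i _ => abs_nonneg _
  have hwk : 0 < w k * ρ k := mul_pos (hw k hk) hρk
  set S : ℝ := N / (w k * ρ k * ρ k) with hS
  have hS0 : 0 ≤ S := div_nonneg hN0 (mul_pos hwk hρk).le
  have hgS : 0 ≤ g S := by
    have hsplit : g S = w k * ρ k * Real.exp (S * ρ k) + ∑ i ∈ L.erase k, w i * ρ i * Real.exp (S * ρ i) := by
      rw [hg]
      exact (Finset.add_sum_erase L (fun i => w i * ρ i * Real.exp (S * ρ i)) hk).symm
    have hterm : ∀ i ∈ L.erase k, -|w i * ρ i| ≤ w i * ρ i * Real.exp (S * ρ i) := by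
      intro i hi
      have hi' : i ∈ L := Finset.mem_of_mem_erase hi
      rcases le_or_gt 0 (ρ i) with hρi | hρi
      · have : 0 ≤ w i * ρ i * Real.exp (S * ρ i) := mul_nonneg (mul_nonneg (hw i hi').le hρi) (Real.exp_pos _).le
        linarith [abs_nonneg (w i * ρ i)]
      · have hwρ : w i * ρ i ≤ 0 := mul_nonpos_of_nonneg_of_nonpos (hw i hi').le hρi.le
        have hexp : Real.exp (S * ρ i) ≤ 1 := Real.exp_le_one_iff.2 (mul_nonpos_of_nonneg_of_nonpos hS0 hρi.le)
        have h1 : w i * ρ i * 1 ≤ w i * ρ i * Real.exp (S * ρ i) := mul_le_mul_of_nonpos_left hexp hwρ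
        rw [abs_of_nonpos hwρ]
        linarith
    have hrest : -N ≤ ∑ i ∈ L.erase k, w i * ρ i * Real.exp (S * ρ i) := by
      rw [hN, ← Finset.sum_neg_distrib]
      exact Finset.sum_le_sum hterm
    have hmain : w k * ρ k * (1 + S * ρ k) ≤ w k * ρ k * Real.exp (S * ρ k) :=
      mul_le_mul_of_nonneg_left (by linarith [Real.add_one_le_exp (S * ρ k)]) hwk.le
    have hval : w k * ρ k * (1 + S * ρ k) = w k * ρ k + N := by
      have hw0 : w k ≠ 0 := ne_of_gt (hw k hk)
      have hρ0 : ρ k ≠ 0 := ne_of_gt hρk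
      rw [hS]
      field_simp
    rw [hsplit]
    linarith
  -- IVT on `[0, S]`
  have hcont : ContinuousOn g (Icc 0 S) := by
    refine Continuous.continuousOn ?_
    rw [hg]
    exact continuous_finsetSum _ fun i _ => (continuous_const.mul continuous_const).mul
      (Real.continuous_exp.comp (continuous_id.mul continuous_const))
  have hg0 : g 0 < 0 := by
    rw [hg]
    simpa using h0
  have hmem : (0 : ℝ) ∈ Icc (g 0) (g S) := ⟨hg0.le, hgS⟩
  obtain ⟨σ, hσ, hgσ⟩ := intermediate_value_Icc hS0 hcont hmem
  exact ⟨σ, hσ.1, Or.inl hgσ⟩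

end ProductPlusOne

end Summit.ValiantsHypothesis.ValiantsHypothesis.Theorems.LacunarySymmetroidMatrixDescartes
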